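import Literature.Probability.RandomPlanarGeometry.SLEBoundaryProximity
import Literature.Probability.RandomPlanarGeometry.SLEUnifiedHitting
import Literature.Probability.RandomPlanarGeometry.SLEOnePointLowerEstimate
import Literature.Probability.RandomPlanarGeometry.CritPercSLESpaceFillingIffTraceEight
import Literature.Probability.RandomPlanarGeometry.CritPercSLE
import HarnessLib

/-!
# `stub_kappaPinHalfPlane`: the κ-pin in half-plane coordinates

Stub S6a `stub_kappaPinHalfPlane` of the registered skeleton of the line `boundary-area-law` for
the crux `SubseqIdentification` (stmt-CriticalPhenomena-0783, route `SAWRenewalTightness`).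

For `κ > 0` such that SLE_κ is generated by a curve (`HasSLETrace κ`) and a real point `u₀ ≠ 0`
of the boundary of the half-plane, with `γ = sleTrace κ ω` the SLE_κ trace:

* (i) non-degeneracy: `P[dist(u₀, γ[0,∞)) < ρ] > 0` for every `ρ > 0`;
* (ii) the pin: a two-sided area law `c ρ² ≤ P[dist ≤ ρ]`, `P[dist < ρ] ≤ C ρ²` for all small
  `ρ` forces `κ = 8/3`.

Proof. `0 < κ < 8`: the Alberts–Kozdron upper bound
`P[dist(u₀, γ) ≤ r|u₀|] ≤ C₁ r^{8/κ-1}` (`r ≤ 1/4`; PROVED in the tree: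
`measure_infDist_ofReal_sleTrace_le` for `u₀ > 0`, `measure_infDist_neg_ofReal_sleTrace_le` for
`u₀ < 0`) against `c ρ² ≤ P[dist ≤ ρ]` gives `c ≤ C₁ |u₀|^{-β} ρ^{β-2}` for all small `ρ`
(`β = 8/κ - 1`), so `β ≤ 2` (let `ρ → 0+`). Beffara's interior one-point LOWER estimate
(`measure_infDist_sleTrace_le_ge`, PROVED) at `z = u₀ + iρ/2`, `ε = ρ/4` gives
`P[dist(u₀, γ) ≤ 3ρ/4] ≥ ½ Ĝ(2u₀/ρ) (1/4)^{1-κ/8}` with the Rohde–Schramm profile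
`Ĝ(w) = (1 + w²)^{-β/2}` (`rsGhatSlope_critical`), and `(1 + 4u₀²/ρ²)^{-β/2} ≥ (ρ²/(5u₀²))^{β/2}`
for `ρ ≤ |u₀|`; against `P[dist < ρ] ≤ C ρ²` this gives `A ρ^β ≤ C ρ²`, so `2 ≤ β`. Hence
`β = 2`, `κ = 8/3`. `κ ≥ 8`: the trace is a.s. space-filling
(`ae_isSpaceFilling_sleTrace_of_hasSLETrace_apply`), so `u₀ ∈ ℍ̄ = γ[0,∞)` a.s. and
`P[dist < ρ] = 1` for every `ρ > 0`, which contradicts `≤ C ρ²` for `ρ` small; (i) is the lower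
estimate (`κ < 8`, `Ĝ > 0`) resp. the space-filling phase (`κ ≥ 8`).

Sources: T. Alberts, M. Kozdron, *Intersection probabilities for a chordal SLE path and a
semicircle*, Electron. Commun. Probab. 13 (2008), Thm 1.1; V. Beffara, *The dimension of the SLE
curves*, Ann. Probab. 36 (2008), Prop. 4; S. Rohde, O. Schramm, *Basic properties of SLE*,
Ann. Math. 161 (2005), Lemma 6.3 and Cor. 7.4. No named fact is used beyond the PROVED tree
theorems quoted; axioms `propext`, `Classical.choice`, `Quot.sound`.
-/

noncomputable section

open MeasureTheory Filter Topology Set Metric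
open scoped NNReal ENNReal

namespace Summit.CriticalPhenomena.SAWScalingLimit.Theorems.SubseqIdentification.BoundaryAreaLaw

open Literature.Probability.RandomPlanarGeometry
open Literature.Probability.Process (preWienerMeasure)
open UpperHalfPlane (upperHalfPlaneSet)

variable {κ : ℝ≥0}

/-- For `κ ≥ 8` the SLE_κ trace is a.s. space-filling (Rohde–Schramm 2005, Cor. 7.4), so every
real point `u₀` lies a.s. ON the trace and the event `{dist(u₀, γ[0,∞)) < ρ}` has probability
one for every `ρ > 0`. -/
private theorem measure_infDist_lt_eq_one_of_eight_le (hκ8 : 8 ≤ κ) (hT : HasSLETrace κ)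
    (u₀ : ℝ) {ρ : ℝ} (hρ : 0 < ρ) :
    preWienerMeasure {ω | infDist (u₀ : ℂ) (range (sleTrace κ ω)) < ρ} = 1 := by
  haveI := isProbabilityMeasure_preWienerMeasure'
  have hmem : ∀ᵐ ω ∂preWienerMeasure,
      ω ∈ {ω | infDist (u₀ : ℂ) (range (sleTrace κ ω)) < ρ} := by
    filter_upwards [ae_isSpaceFilling_sleTrace_of_hasSLETrace_apply hκ8 hT] with ω hω
    have hrange : range (sleTrace κ ω) = closure upperHalfPlaneSet := hω
    have hu : (u₀ : ℂ) ∈ range (sleTrace κ ω) := by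
      rw [hrange, show upperHalfPlaneSet = {w : ℂ | 0 < w.im} from rfl,
        Complex.closure_setOf_lt_im]
      simp
    show infDist (u₀ : ℂ) (range (sleTrace κ ω)) < ρ
    rw [infDist_zero_of_mem hu]
    exact hρ
  exact (measure_congr (ae_eq_univ.2 (mem_ae_iff.1 hmem))).trans measure_univ

/-- Beffara's interior one-point lower estimate (Beffara 2008, Prop. 4; tree:
`measure_infDist_sleTrace_le_ge`) read at the boundary: looking at `z = u₀ + iρ/2` with
`ε = ρ/4` (`dist(z, γ) ≤ ρ/4 ⇒ dist(u₀, γ) ≤ 3ρ/4`),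
`P[dist(u₀, γ[0,∞)) ≤ 3ρ/4] ≥ ½ Ĝ_{1-κ/8,κ}(2u₀/ρ) (1/4)^{1-κ/8}` for `0 < κ < 8`, `ρ > 0`. -/
private theorem lowerEstimate_boundary (hκ : 0 < κ) (hκ8 : κ < 8) (hT : HasSLETrace κ)
    (u₀ : ℝ) {ρ : ℝ} (hρ : 0 < ρ) :
    ENNReal.ofReal (rsGhatSlope (1 - (κ : ℝ) / 8) κ (u₀ / (ρ / 2)) / 2 *
        (1 / 4 : ℝ) ^ (1 - (κ : ℝ) / 8)) ≤
      preWienerMeasure {ω | infDist (u₀ : ℂ) (range (sleTrace κ ω)) ≤ 3 * ρ / 4} := by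
  set z : ℂ := ⟨u₀, ρ / 2⟩ with hz
  have hzim : z.im = ρ / 2 := rfl
  have hzre : z.re = u₀ := rfl
  have hzim0 : 0 < z.im := by rw [hzim]; positivity
  have hε : (0 : ℝ) < ρ / 4 := by positivity
  have hεz : ρ / 4 < z.im := by rw [hzim]; linarith
  have h := measure_infDist_sleTrace_le_ge hκ hκ8 hT hzim0 hε hεz
  rw [hzre, hzim] at h
  have h4 : ρ / 4 / (2 * (ρ / 2)) = 1 / 4 := by
    field_simp
  rw [h4] at h
  refine h.trans (measure_mono fun ω hω => ?_)
  simp only [mem_setOf_eq] at hω ⊢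
  have hdist : dist (u₀ : ℂ) z = ρ / 2 := by
    rw [Complex.dist_of_re_eq (by simp [hzre]), Complex.ofReal_im, hzim, Real.dist_eq,
      zero_sub, abs_neg, abs_of_pos (by positivity)]
  calc infDist (u₀ : ℂ) (range (sleTrace κ ω))
      ≤ infDist z (range (sleTrace κ ω)) + dist (u₀ : ℂ) z := infDist_le_infDist_add_dist
    _ ≤ ρ / 4 + ρ / 2 := add_le_add hω hdist.le
    _ = 3 * ρ / 4 := by ring

/-- The Alberts–Kozdron upper bound (Alberts–Kozdron 2008, Thm 1.1 / 3.2; tree: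
`measure_infDist_ofReal_sleTrace_le`, `measure_infDist_neg_ofReal_sleTrace_le`) at a real point of
either sign: `P[dist(u₀, γ[0,∞)) ≤ r |u₀|] ≤ C₁ r^{8/κ-1}` for `0 < r ≤ 1/4`
(`0 < κ < 8`, `u₀ ≠ 0`). -/
private theorem upperEstimate_abs (hκ : 0 < κ) (hκ8 : κ < 8) (hT : HasSLETrace κ) {u₀ : ℝ}
    (hu₀ : u₀ ≠ 0) :
    ∃ C₁ : ℝ, 0 ≤ C₁ ∧ ∀ {r : ℝ}, 0 < r → r ≤ 1 / 4 →
      preWienerMeasure {ω | infDist (u₀ : ℂ) (range (sleTrace κ ω)) ≤ r * |u₀|} ≤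
        ENNReal.ofReal (C₁ * r ^ (8 / (κ : ℝ) - 1)) := by
  rcases lt_or_gt_of_ne hu₀ with hneg | hpos
  · obtain ⟨C₁, hC₁, h⟩ := measure_infDist_neg_ofReal_sleTrace_le hκ hκ8 hT
    exact ⟨C₁, hC₁, fun {r} hr hr4 => h hneg hr hr4⟩
  · obtain ⟨C₁, hC₁, h⟩ := measure_infDist_ofReal_sleTrace_le hκ hκ8 hT
    refine ⟨C₁, hC₁, fun {r} hr hr4 => ?_⟩
    rw [abs_of_pos hpos]
    exact h hpos hr hr4

/-- A lower area law `c ρ² ≤ P[dist(u₀, γ[0,∞)) ≤ ρ]` for small `ρ` against the Alberts–Kozdron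
upper bound `P[dist ≤ ρ] ≤ C₁ (ρ/|u₀|)^{8/κ-1}` forces `8/κ - 1 ≤ 2` (`0 < κ < 8`, `u₀ ≠ 0`):
otherwise `c ≤ C₁ |u₀|^{-β} ρ^{β-2} → 0` as `ρ → 0+`. -/
private theorem exponent_le_two (hκ : 0 < κ) (hκ8 : κ < 8) (hT : HasSLETrace κ) {u₀ : ℝ}
    (hu₀ : u₀ ≠ 0) {c ρ₀ : ℝ} (hc : 0 < c) (hρ₀ : 0 < ρ₀)
    (H : ∀ ρ ∈ Ioo (0 : ℝ) ρ₀, ENNReal.ofReal (c * ρ ^ 2) ≤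
      preWienerMeasure {ω | infDist (u₀ : ℂ) (range (sleTrace κ ω)) ≤ ρ}) :
    8 / (κ : ℝ) - 1 ≤ 2 := by
  obtain ⟨C₁, hC₁, hU⟩ := upperEstimate_abs hκ hκ8 hT hu₀
  obtain ⟨β, hβ⟩ : ∃ β : ℝ, β = 8 / (κ : ℝ) - 1 := ⟨_, rfl⟩
  rw [← hβ] at hU ⊢
  by_contra! h2
  have ha : 0 < |u₀| := abs_pos.2 hu₀
  have haβ : 0 < |u₀| ^ β := Real.rpow_pos_of_pos ha β
  -- for small `ρ`: `c ≤ (C₁ / |u₀|^β) ρ^{β-2}`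
  have key : ∀ᶠ ρ in 𝓝[>] (0 : ℝ), c ≤ C₁ / |u₀| ^ β * ρ ^ (β - 2) := by
    have hδ : (0 : ℝ) < min ρ₀ (|u₀| / 4) := lt_min hρ₀ (by positivity)
    filter_upwards [Ioo_mem_nhdsGT hδ] with ρ hρ
    obtain ⟨hρ0, hρδ⟩ := hρ
    have hρ₀' : ρ < ρ₀ := hρδ.trans_le (min_le_left _ _)
    have hρu : ρ ≤ |u₀| / 4 := hρδ.le.trans (min_le_right _ _)
    have hr : 0 < ρ / |u₀| := div_pos hρ0 ha
    have hr4 : ρ / |u₀| ≤ 1 / 4 := by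
      rw [div_le_iff₀ ha]
      linarith
    have h1 := H ρ ⟨hρ0, hρ₀'⟩
    have h2 := hU hr hr4
    rw [div_mul_cancel₀ ρ ha.ne'] at h2
    have h3 : c * ρ ^ 2 ≤ C₁ * (ρ / |u₀|) ^ β := by
      rcases ENNReal.ofReal_le_ofReal_iff'.1 (h1.trans h2) with h | h
      · exact h
      · exact absurd h (not_le.2 (by positivity))
    have h5 : C₁ * (ρ / |u₀|) ^ β = C₁ / |u₀| ^ β * ρ ^ (β - 2) * ρ ^ 2 := by
      rw [Real.div_rpow hρ0.le ha.le, Real.rpow_sub hρ0 β 2, Real.rpow_two]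
      field_simp
    rw [h5] at h3
    exact le_of_mul_le_mul_right h3 (by positivity)
  have hlim : Tendsto (fun ρ : ℝ => C₁ / |u₀| ^ β * ρ ^ (β - 2)) (𝓝[>] 0) (𝓝 0) := by
    have h0 : Tendsto (fun ρ : ℝ => ρ ^ (β - 2)) (𝓝 (0 : ℝ)) (𝓝 0) := by
      have h := (Real.continuousAt_rpow_const 0 (β - 2) (Or.inr (by linarith))).tendsto
      rwa [Real.zero_rpow (by linarith : β - 2 ≠ 0)] at h
    have h : Tendsto (fun ρ : ℝ => C₁ / |u₀| ^ β * ρ ^ (β - 2)) (𝓝[>] 0)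
        (𝓝 (C₁ / |u₀| ^ β * 0)) :=
      (h0.mono_left nhdsWithin_le_nhds).const_mul (C₁ / |u₀| ^ β)
    rwa [mul_zero] at h
  have := ge_of_tendsto hlim key
  linarith

/-- Beffara's lower bound `P[dist(u₀, γ[0,∞)) ≤ 3ρ/4] ≥ (A/D) ρ^{8/κ-1}` (for `ρ ≤ |u₀|`) against
an upper area law `P[dist < ρ] ≤ C ρ²` for small `ρ` forces `2 ≤ 8/κ - 1` (`0 < κ < 8`,
`u₀ ≠ 0`): otherwise `A/D ≤ C ρ^{2-β} → 0` as `ρ → 0+`. -/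
private theorem two_le_exponent (hκ : 0 < κ) (hκ8 : κ < 8) (hT : HasSLETrace κ) {u₀ : ℝ}
    (hu₀ : u₀ ≠ 0) {C ρ₀ : ℝ} (hρ₀ : 0 < ρ₀)
    (H : ∀ ρ ∈ Ioo (0 : ℝ) ρ₀,
      preWienerMeasure {ω | infDist (u₀ : ℂ) (range (sleTrace κ ω)) < ρ} ≤
        ENNReal.ofReal (C * ρ ^ 2)) :
    2 ≤ 8 / (κ : ℝ) - 1 := by
  have hκ0 : (0 : ℝ) < κ := by exact_mod_cast hκ
  have hκne : (κ : ℝ) ≠ 0 := hκ0.ne'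
  have hκ8' : (κ : ℝ) < 8 := by exact_mod_cast hκ8
  obtain ⟨β, hβ⟩ : ∃ β : ℝ, β = 8 / (κ : ℝ) - 1 := ⟨_, rfl⟩
  rw [← hβ]
  have hβ0 : 0 < β := by
    have h8 : (1 : ℝ) < 8 / κ := (one_lt_div hκ0).2 hκ8'
    rw [hβ]
    linarith
  by_contra! h2
  have ha : 0 < |u₀| := abs_pos.2 hu₀
  -- the constants
  obtain ⟨A, hA⟩ : ∃ A : ℝ, A = (1 / 4 : ℝ) ^ (1 - (κ : ℝ) / 8) / 2 := ⟨_, rfl⟩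
  have hA0 : 0 < A := by rw [hA]; positivity
  obtain ⟨D, hD⟩ : ∃ D : ℝ, D = (5 * u₀ ^ 2) ^ (β / 2) := ⟨_, rfl⟩
  have hD0 : 0 < D := by rw [hD]; exact Real.rpow_pos_of_pos (by positivity) _
  have hexp : -((8 - (κ : ℝ)) / (2 * κ)) = -(β / 2) := by
    rw [hβ, div_sub_one hκne]
    ring
  have key : ∀ᶠ ρ in 𝓝[>] (0 : ℝ), A / D ≤ C * ρ ^ (2 - β) := by
    have hδ : (0 : ℝ) < min ρ₀ |u₀| := lt_min hρ₀ ha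
    filter_upwards [Ioo_mem_nhdsGT hδ] with ρ hρ
    obtain ⟨hρ0, hρδ⟩ := hρ
    have hρ₀' : ρ < ρ₀ := hρδ.trans_le (min_le_left _ _)
    have hρu : ρ ≤ |u₀| := hρδ.le.trans (min_le_right _ _)
    -- the chain `ofReal (Ĝ/2 (1/4)^a) ≤ P[dist ≤ 3ρ/4] ≤ P[dist < ρ] ≤ ofReal (C ρ²)`
    have h1 := lowerEstimate_boundary hκ hκ8 hT u₀ hρ0
    have h12 : preWienerMeasure {ω | infDist (u₀ : ℂ) (range (sleTrace κ ω)) ≤ 3 * ρ / 4} ≤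
        preWienerMeasure {ω | infDist (u₀ : ℂ) (range (sleTrace κ ω)) < ρ} :=
      measure_mono fun ω hω => by
        simp only [mem_setOf_eq] at hω ⊢
        linarith
    have h3 := (h1.trans h12).trans (H ρ ⟨hρ0, hρ₀'⟩)
    -- the slope factor: `(A/D) ρ^β ≤ Ĝ(2u₀/ρ)/2 (1/4)^a`
    have hg : A / D * ρ ^ β ≤ rsGhatSlope (1 - (κ : ℝ) / 8) κ (u₀ / (ρ / 2)) / 2 *
        (1 / 4 : ℝ) ^ (1 - (κ : ℝ) / 8) := by
      rw [rsGhatSlope_critical hκ0, hexp]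
      have hw : 1 + (u₀ / (ρ / 2)) ^ 2 ≤ 5 * u₀ ^ 2 / ρ ^ 2 := by
        rw [le_div_iff₀ (by positivity)]
        have hρ2 : ρ ^ 2 ≤ u₀ ^ 2 := by
          calc ρ ^ 2 ≤ |u₀| ^ 2 := by gcongr
            _ = u₀ ^ 2 := sq_abs u₀
        have h' : (u₀ / (ρ / 2)) ^ 2 * ρ ^ 2 = 4 * u₀ ^ 2 := by
          field_simp
          ring
        nlinarith [h']
      have hlow : (5 * u₀ ^ 2 / ρ ^ 2) ^ (-(β / 2)) ≤ (1 + (u₀ / (ρ / 2)) ^ 2) ^ (-(β / 2)) :=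
        Real.rpow_le_rpow_of_nonpos (by positivity) hw (by linarith)
      have hrew : (5 * u₀ ^ 2 / ρ ^ 2) ^ (-(β / 2)) = ρ ^ β / D := by
        rw [Real.rpow_neg (by positivity), Real.div_rpow (by positivity) (by positivity), inv_div,
          hD]
        congr 1
        rw [← Real.rpow_natCast, ← Real.rpow_mul hρ0.le]
        congr 1
        push_cast
        ring
      calc A / D * ρ ^ β = ρ ^ β / D * A := by ring
        _ ≤ (1 + (u₀ / (ρ / 2)) ^ 2) ^ (-(β / 2)) * A := by
            rw [← hrew]
            exact mul_le_mul_of_nonneg_right hlow hA0.le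
        _ = _ := by rw [hA]; ring
    have h4 : A / D * ρ ^ β ≤ C * ρ ^ 2 := by
      have h5 : ENNReal.ofReal (A / D * ρ ^ β) ≤ ENNReal.ofReal (C * ρ ^ 2) :=
        (ENNReal.ofReal_le_ofReal hg).trans h3
      rcases ENNReal.ofReal_le_ofReal_iff'.1 h5 with h | h
      · exact h
      · exact absurd h (not_le.2 (by positivity))
    have hρβ : 0 < ρ ^ β := Real.rpow_pos_of_pos hρ0 β
    rw [Real.rpow_sub hρ0 2 β, Real.rpow_two, mul_div_assoc', le_div_iff₀ hρβ]
    exact h4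
  have hlim : Tendsto (fun ρ : ℝ => C * ρ ^ (2 - β)) (𝓝[>] 0) (𝓝 0) := by
    have h0 : Tendsto (fun ρ : ℝ => ρ ^ (2 - β)) (𝓝 (0 : ℝ)) (𝓝 0) := by
      have h := (Real.continuousAt_rpow_const 0 (2 - β) (Or.inr (by linarith))).tendsto
      rwa [Real.zero_rpow (by linarith : 2 - β ≠ 0)] at h
    have h : Tendsto (fun ρ : ℝ => C * ρ ^ (2 - β)) (𝓝[>] 0) (𝓝 (C * 0)) :=
      (h0.mono_left nhdsWithin_le_nhds).const_mul C
    rwa [mul_zero] at h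
  have := ge_of_tendsto hlim key
  have : 0 < A / D := div_pos hA0 hD0
  linarith

/-- **S6a — the κ-pin in the half-plane** (registered stub `stub_kappaPinHalfPlane` of the line
`boundary-area-law`, crux `SubseqIdentification`, stmt-CriticalPhenomena-0783). For `κ > 0` with
`HasSLETrace κ` and a real `u₀ ≠ 0`, with `γ = sleTrace κ ω` the SLE_κ trace in `(ℍ; 0, ∞)`:
(i) `P[dist(u₀, γ[0,∞)) < ρ] > 0` for every `ρ > 0`; (ii) a two-sided area law
`c ρ² ≤ P[dist ≤ ρ]`, `P[dist < ρ] ≤ C ρ²` for all `ρ ∈ (0, ρ₀)` forces `κ = 8/3`.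
Route: for `κ < 8` the boundary exponent is `8/κ - 1` from both sides (Alberts–Kozdron upper
bound `upperEstimate_abs`, Beffara lower bound `lowerEstimate_boundary` with the closed form
`rsGhatSlope_critical` of the Rohde–Schramm profile), and `8/κ - 1 = 2` iff `κ = 8/3`
(`exponent_le_two`, `two_le_exponent`); for `κ ≥ 8` the trace is a.s. space-filling, so
`P[dist < ρ] = 1` for all `ρ` (`measure_infDist_lt_eq_one_of_eight_le`), incompatible with
`≤ C ρ²`. -/
theorem stub_kappaPinHalfPlane :
    ∀ (κ : ℝ≥0), 0 < κ → HasSLETrace κ → ∀ (u₀ : ℝ), u₀ ≠ 0 →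
      (∀ ρ : ℝ, 0 < ρ →
          0 < preWienerMeasure {ω | Metric.infDist (u₀ : ℂ) (Set.range (sleTrace κ ω)) < ρ}) ∧
        ((∃ c C ρ₀ : ℝ, 0 < c ∧ 0 < ρ₀ ∧ ∀ ρ ∈ Set.Ioo (0 : ℝ) ρ₀,
            ENNReal.ofReal (c * ρ ^ 2) ≤
                preWienerMeasure {ω | Metric.infDist (u₀ : ℂ) (Set.range (sleTrace κ ω)) ≤ ρ} ∧
              preWienerMeasure {ω | Metric.infDist (u₀ : ℂ) (Set.range (sleTrace κ ω)) < ρ} ≤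
                ENNReal.ofReal (C * ρ ^ 2)) →
          κ = 8 / 3) := by
  intro κ hκ hT u₀ hu₀
  refine ⟨fun ρ hρ => ?_, ?_⟩
  · -- (i) non-degeneracy
    rcases lt_or_ge κ 8 with hκ8 | hκ8
    · have hκ0 : (0 : ℝ) < κ := by exact_mod_cast hκ
      have hκ8' : (κ : ℝ) ≤ 8 := by exact_mod_cast hκ8.le
      have h1 := lowerEstimate_boundary hκ hκ8 hT u₀ hρ
      have hpos : 0 < rsGhatSlope (1 - (κ : ℝ) / 8) κ (u₀ / (ρ / 2)) / 2 *
          (1 / 4 : ℝ) ^ (1 - (κ : ℝ) / 8) := by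
        have := (rsGhatSlope_critical_mem_Ioc hκ0 hκ8' (u₀ / (ρ / 2))).1
        positivity
      have h2 : preWienerMeasure {ω | infDist (u₀ : ℂ) (range (sleTrace κ ω)) ≤ 3 * ρ / 4} ≤
          preWienerMeasure {ω | infDist (u₀ : ℂ) (range (sleTrace κ ω)) < ρ} :=
        measure_mono fun ω hω => by
          simp only [mem_setOf_eq] at hω ⊢
          linarith
      exact ((ENNReal.ofReal_pos.2 hpos).trans_le h1).trans_le h2
    · rw [measure_infDist_lt_eq_one_of_eight_le hκ8 hT u₀ hρ]
      exact one_pos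
  · -- (ii) the pin
    rintro ⟨c, C, ρ₀, hc, hρ₀, H⟩
    rcases lt_or_ge κ 8 with hκ8 | hκ8
    · have hle := exponent_le_two hκ hκ8 hT hu₀ hc hρ₀ fun ρ hρ => (H ρ hρ).1
      have hge := two_le_exponent hκ hκ8 hT hu₀ hρ₀ fun ρ hρ => (H ρ hρ).2
      have hκ0 : (0 : ℝ) < κ := by exact_mod_cast hκ
      have hκne : (κ : ℝ) ≠ 0 := hκ0.ne'
      have hβ : 8 / (κ : ℝ) - 1 = 2 := le_antisymm hle hge
      have hκR : (κ : ℝ) = 8 / 3 := by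
        field_simp at hβ
        linarith
      exact NNReal.eq (by rw [hκR]; norm_num)
    · -- `κ ≥ 8`: `P[dist < ρ] = 1 ≤ C ρ² < 1` for `ρ` small
      exfalso
      obtain ⟨ρ, hρ⟩ : ∃ ρ : ℝ, ρ = min (ρ₀ / 2) (1 / (|C| + 2)) := ⟨_, rfl⟩
      have hC2 : 0 < |C| + 2 := by positivity
      have hρ0 : 0 < ρ := by rw [hρ]; exact lt_min (by positivity) (by positivity)
      have hρ₀' : ρ < ρ₀ := by rw [hρ]; exact (min_le_left _ _).trans_lt (by linarith)
      have hρ1 : ρ ≤ 1 / (|C| + 2) := by rw [hρ]; exact min_le_right _ _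
      have hρle1 : ρ ≤ 1 := hρ1.trans (by rw [div_le_one hC2]; linarith [abs_nonneg C])
      have h := (H ρ ⟨hρ0, hρ₀'⟩).2
      rw [measure_infDist_lt_eq_one_of_eight_le hκ8 hT u₀ hρ0] at h
      have hlt : C * ρ ^ 2 < 1 := by
        have h1 : C * ρ ^ 2 ≤ |C| * ρ ^ 2 :=
          mul_le_mul_of_nonneg_right (le_abs_self C) (sq_nonneg ρ)
        have hρsq : ρ ^ 2 ≤ ρ := by nlinarith
        have h2 : |C| * ρ ^ 2 ≤ |C| * ρ := mul_le_mul_of_nonneg_left hρsq (abs_nonneg C)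
        have h3 : |C| * ρ ≤ |C| * (1 / (|C| + 2)) := mul_le_mul_of_nonneg_left hρ1 (abs_nonneg C)
        have h4 : |C| * (1 / (|C| + 2)) < 1 := by
          rw [mul_one_div, div_lt_one hC2]
          linarith
        linarith
      exact (not_lt.2 h) (ENNReal.ofReal_lt_one.2 hlt)

end Summit.CriticalPhenomena.SAWScalingLimit.Theorems.SubseqIdentification.BoundaryAreaLaw

end
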